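import Summits.Ventures.QEC.Census.TwoBlockCyclicKernel
import Summits.Ventures.QEC.Census.TwoBlockQuotientMaps
import HarnessLib

/-!
# Abelian two-block codes: the kernel-weight bound for subgroups with CYCLIC Sylow 2-subgroup
# (cyclic 2-power theorem ∘ odd-index quotient lemma)

`Census/TwoBlockCyclicKernel.lean` (qec-search-3): if `y` has order `2^r` and the indicator of `⟨y⟩` lies in `ker A ∩ ker B`
of the abelian two-block code `css a b` over `𝔽₂[G]`, then `(1_⟨y⟩, 0)` or `(0, 1_⟨y⟩)` is a non-trivial `Z`-logical.
`Census/TwoBlockQuotientMaps.lean` (qec-search-8): along a surjection `φ : G ↠ G'` of ODD index, logical operators of the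
push-forward code `css (φ_* a) (φ_* b)` pull back to logical operators, weights multiplied by `|ker φ|`.

Composed here (`css_dZ_le_of_indicator_comp_mem_ker`, `sumElim_indicator_comp_not_mem_rowSpace_or`): for EVERY surjection
`φ : G ↠ G'` with `|ker φ|` odd and every `y' ∈ G'` of order `2^r`, if the indicator `1_H = 1_⟨y'⟩ ∘ φ` of the subgroup
`H = φ⁻¹⟨y'⟩` (order `|ker φ| · 2^r`) lies in `ker A ∩ ker B`, then `(1_H, 0)` or `(0, 1_H)` is a non-trivial `Z`-logical
of `css a b`, so **`d_Z ≤ |ker φ| · 2^r = |H|`** (and `d_X`).  This covers exactly the subgroups `H ≤ G` whose Sylow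
2-subgroup `P` is CYCLIC: writing `H = K₀ ⊕ P` (`K₀` the odd part) and taking `φ = G ↠ G/K₀`, `φ(H) ≅ P` is cyclic of order
`2^r` and `φ⁻¹φ(H) = H`; in particular every CYCLIC `H` (any order).  By contrast for `H ≅ ℤ₂ × ℤ₂` the bound fails
(`Census/BB/TwoBlockKernelWeightCounterexample.lean`).  So, for subgroup indicators in `ker A ∩ ker B`, the cell's refuted
data-conjecture X-2 («`d ≤ d(ker A ∩ ker B)`») survives as a THEOREM precisely on the cyclic-Sylow-2 side of the dichotomy.

HONEST FRAMING: a composition of two structural lemmas of the cell (ours); no printed statement formalized or contradicted;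
the quotient `G ↠ G/K₀` is supplied by the user as `φ` (no quotient-group construction here).  All proved, axioms standard,
0 kit.
-/

namespace Summit.Ventures.QEC.TwoBlockCyclicKernel

open Matrix Literature.InformationTheory.QuantumCodes Literature.InformationTheory.QuantumCodes.AbelianTwoBlock
open Summit.Ventures.QEC.AbelianTwoBlock Summit.Ventures.QEC.TwoBlockOrderTwo

variable {G G' : Type*} [Fintype G] [AddCommGroup G] [DecidableEq G]
  [Fintype G'] [AddCommGroup G'] [DecidableEq G']

omit [Fintype G'] [DecidableEq G] in
/-- `φ_* 0 = 0`. [folklore] -/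
theorem push_zero (φ : G →+ G') : push φ (0 : G → ZMod 2) = 0 := by
  funext g'; simp [push]

omit [DecidableEq G] in
/-- Along an odd-index surjection, a kernel condition upstairs for a pulled-back indicator pushes down:
`A (u ∘ φ) = 0 ⇒ (φ_* A) u = 0`. -/
theorem circulant_push_mulVec_eq_zero (φ : G →+ G') (hφ : Function.Surjective φ) (hodd : Odd (fibreCard φ))
    {a : G → ZMod 2} {u : G' → ZMod 2} (ha : circulant a *ᵥ (u ∘ φ) = 0) :
    circulant (push φ a) *ᵥ u = 0 := by
  have h := congrArg (push φ) ha
  rw [push_circulant_mulVec, push_comp φ hφ, ZMod.natCast_eq_one_iff_odd.2 hodd, one_smul, push_zero] at h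
  exact h

omit [DecidableEq G] in
/-- **`(1_H, 0)` or `(0, 1_H)` is a non-trivial `Z`-vector for `H = φ⁻¹⟨y'⟩`**, `φ : G ↠ G'` of odd index, `y'` of order
`2^r`, whenever `1_H = 1_⟨y'⟩ ∘ φ` lies in `ker A ∩ ker B`: the one-block logical of the quotient code (cyclic 2-power theorem)
pulls back (odd index). -/
theorem sumElim_indicator_comp_not_mem_rowSpace_or (φ : G →+ G') (hφ : Function.Surjective φ)
    (hodd : Odd (fibreCard φ)) {y' : G'} {r : ℕ} (hy : addOrderOf y' = 2 ^ r) {a b : G → ZMod 2}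
    (ha : circulant a *ᵥ (indH (AddSubgroup.zmultiples y') ∘ φ) = 0)
    (hb : circulant b *ᵥ (indH (AddSubgroup.zmultiples y') ∘ φ) = 0) :
    Sum.elim (indH (AddSubgroup.zmultiples y') ∘ φ) (0 : G → ZMod 2) ∉ (css a b).rowSpZ ∨
      Sum.elim (0 : G → ZMod 2) (indH (AddSubgroup.zmultiples y') ∘ φ) ∉ (css a b).rowSpZ := by
  have ha' := circulant_push_mulVec_eq_zero φ hφ hodd ha
  have hb' := circulant_push_mulVec_eq_zero φ hφ hodd hb
  rcases sumElim_indicator_not_mem_rowSpace_or hy ha' hb' with h | h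
  · left
    have hp : pull φ (Sum.elim (indH (AddSubgroup.zmultiples y')) (0 : G' → ZMod 2)) =
        Sum.elim (indH (AddSubgroup.zmultiples y') ∘ φ) (0 : G → ZMod 2) := by
      funext q; rcases q with g | g <;> rfl
    rw [← hp]
    exact pull_not_mem_rowSpZ φ hφ hodd a b h
  · right
    have hp : pull φ (Sum.elim (0 : G' → ZMod 2) (indH (AddSubgroup.zmultiples y'))) =
        Sum.elim (0 : G → ZMod 2) (indH (AddSubgroup.zmultiples y') ∘ φ) := by
      funext q; rcases q with g | g <;> rfl
    rw [← hp]
    exact pull_not_mem_rowSpZ φ hφ hodd a b h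

omit [DecidableEq G] in
/-- `|1_⟨y'⟩ ∘ φ| = |ker φ| · ord y'`. -/
theorem hammingNorm_indH_comp (φ : G →+ G') (hφ : Function.Surjective φ) (y' : G') :
    hammingNorm (indH (AddSubgroup.zmultiples y') ∘ φ) = fibreCard φ * addOrderOf y' := by
  rw [hammingNorm_comp φ hφ, hammingNorm_indH_zmultiples]

omit [DecidableEq G] in
/-- **Kernel-weight bound, cyclic Sylow-2 case.**  For every odd-index surjection `φ : G ↠ G'` of finite abelian groups,
every `y' ∈ G'` of order `2^r`, and `a, b ∈ 𝔽₂[G]`: if `1_H = 1_⟨y'⟩ ∘ φ` (the indicator of `H = φ⁻¹⟨y'⟩`, a subgroup of order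
`|ker φ|·2^r` with cyclic Sylow 2-subgroup — and every such subgroup arises this way) satisfies `A·1_H = B·1_H = 0`, then
`d_Z(css a b) ≤ |ker φ| · 2^r = |1_H|`. -/
theorem css_dZ_le_of_indicator_comp_mem_ker (φ : G →+ G') (hφ : Function.Surjective φ)
    (hodd : Odd (fibreCard φ)) {y' : G'} {r : ℕ} (hy : addOrderOf y' = 2 ^ r) {a b : G → ZMod 2}
    (ha : circulant a *ᵥ (indH (AddSubgroup.zmultiples y') ∘ φ) = 0)
    (hb : circulant b *ᵥ (indH (AddSubgroup.zmultiples y') ∘ φ) = 0) :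
    (css a b).dZ ≤ fibreCard φ * 2 ^ r := by
  rw [← hy, ← hammingNorm_indH_comp φ hφ y']
  rcases sumElim_indicator_comp_not_mem_rowSpace_or φ hφ hodd hy ha hb with h | h
  · have hker : (css a b).HX *ᵥ Sum.elim (indH (AddSubgroup.zmultiples y') ∘ φ) (0 : G → ZMod 2) = 0 := by
      rw [css_HX, HX_mulVec_sumElim, Matrix.mulVec_zero, add_zero, ha]
    have hw : hammingNorm (Sum.elim (indH (AddSubgroup.zmultiples y') ∘ φ) (0 : G → ZMod 2)) =
        hammingNorm (indH (AddSubgroup.zmultiples y') ∘ φ) := by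
      rw [hammingNorm_sumElim, hammingNorm_zero, add_zero]
    rw [← hw]
    exact (css a b).dZ_le_hammingNorm hker h
  · have hker : (css a b).HX *ᵥ Sum.elim (0 : G → ZMod 2) (indH (AddSubgroup.zmultiples y') ∘ φ) = 0 := by
      rw [css_HX, HX_mulVec_sumElim, Matrix.mulVec_zero, zero_add, hb]
    have hw : hammingNorm (Sum.elim (0 : G → ZMod 2) (indH (AddSubgroup.zmultiples y') ∘ φ)) =
        hammingNorm (indH (AddSubgroup.zmultiples y') ∘ φ) := by
      rw [hammingNorm_sumElim, hammingNorm_zero, zero_add]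
    rw [← hw]
    exact (css a b).dZ_le_hammingNorm hker h

omit [DecidableEq G] in
/-- Likewise `d_X(css a b) ≤ |ker φ| · 2^r`. -/
theorem css_dX_le_of_indicator_comp_mem_ker (φ : G →+ G') (hφ : Function.Surjective φ)
    (hodd : Odd (fibreCard φ)) {y' : G'} {r : ℕ} (hy : addOrderOf y' = 2 ^ r) {a b : G → ZMod 2}
    (ha : circulant a *ᵥ (indH (AddSubgroup.zmultiples y') ∘ φ) = 0)
    (hb : circulant b *ᵥ (indH (AddSubgroup.zmultiples y') ∘ φ) = 0) :
    (css a b).dX ≤ fibreCard φ * 2 ^ r := by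
  rw [css_dX_eq_dZ]
  exact css_dZ_le_of_indicator_comp_mem_ker φ hφ hodd hy ha hb

omit [DecidableEq G] in
/-- X-2's shape: **`d_Z ≤ |e|` for the kernel element `e = 1_⟨y'⟩ ∘ φ`** (`φ` odd index, `y'` of order `2^r`). -/
theorem css_dZ_le_hammingNorm_indicator_comp (φ : G →+ G') (hφ : Function.Surjective φ)
    (hodd : Odd (fibreCard φ)) {y' : G'} {r : ℕ} (hy : addOrderOf y' = 2 ^ r) {a b : G → ZMod 2}
    (ha : circulant a *ᵥ (indH (AddSubgroup.zmultiples y') ∘ φ) = 0)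
    (hb : circulant b *ᵥ (indH (AddSubgroup.zmultiples y') ∘ φ) = 0) :
    (css a b).dZ ≤ hammingNorm (indH (AddSubgroup.zmultiples y') ∘ φ) := by
  rw [hammingNorm_indH_comp φ hφ, hy]
  exact css_dZ_le_of_indicator_comp_mem_ker φ hφ hodd hy ha hb

end Summit.Ventures.QEC.TwoBlockCyclicKernel
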